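import Mathlib
import Summits.ValiantsHypothesis.ValiantsHypothesis.Theorems.LiouvilleSarnakAlignedTypeICharactersMod2nStubIsCrux
import HarnessLib

/-!
# Route LiouvilleSarnak — support `AlignedTypeI` (stmt-ValiantsHypothesis-21040) is a rung of the crux
# `DigitalBilinearLiouville` (stmt-ValiantsHypothesis-14774): the aligned cut with `w ≡ 1`, `u = signs`

The route file describes `AlignedTypeI` as "the special case `u` = signs, `w ≡ 1` of 14774 on the ALIGNED cut".  This
file proves that sentence by name: `alignedTypeI_of_digitalBilinearLiouville : DigitalBilinearLiouville → AlignedTypeI`.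

* §1 The ALIGNED balanced cut `π = finSumFinEquiv.trans (finCongr (two_mul n).symm) : Fin n ⊕ Fin n ≃ Fin (2n)` (row
  bits = the `n` low binary digits, column bits = the `n` high digits) has
  `bin(r, c; π) = ofBits r + 2^n · ofBits c` (`ofBits_alignedCut`), and `r ↦ ofBits r` is a bijection
  `(Fin n → Bool) → Fin (2^n)` (`sum_boolVec_eq_sum_fin`), so the cut matrix of `π` is the aligned matrix
  `(λ(a + 2^n b + 1))_{a,b<2^n}` of `AlignedTypeI`.
* §2 With `w ≡ 1` and `u(r) = ±1` the sign of the row sum, the bilinear bound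
  `|Σ_{r,c} u(r) w(c) λ(1 + bin(r,c;π))|² ≤ ε² 4^n ‖u‖² ‖w‖² = (ε 4^n)²` is `(Σ_a |Σ_b λ(a + 2^n b + 1)|)² ≤ (ε 4^n)²`.

Together with `kmtVariance_iff_alignedTypeI` and `twistedLiouvilleSmall_of_alignedTypeI` (`…StubIsCrux.lean`) the chain of
the route's registered propositions at this leaf reads
`DigitalBilinearLiouville → AlignedTypeI ↔ KMTVariance → TwistedLiouvilleSmall` (`twistedLiouvilleSmall_of_digitalBilinearLiouville`).

HONEST FRAMING.  `DigitalBilinearLiouville` is an OPEN conjecture-shaped crux (held milestone); this file proves an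
implication FROM it, i.e. that `AlignedTypeI` is necessary for it — no progress on either statement, nothing is
closed, and nothing here bears on `VP ≠ VNP` (NOT proved).
-/

set_option linter.dupNamespace false

noncomputable section

namespace Summit.ValiantsHypothesis.ValiantsHypothesis.Theorems.LiouvilleSarnak.AlignedTypeI.CharactersModTwoN

open ArithmeticFunction Finset
open scoped BigOperators

/-! ## §1 The aligned cut -/

/-- On the aligned cut, the integer with row bits `r` (low) and column bits `c` (high) is
`ofBits r + 2^n · ofBits c`. [folklore] -/
theorem ofBits_alignedCut (n : ℕ) (r c : Fin n → Bool) :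
    Nat.ofBits (fun j : Fin (2 * n) => Sum.elim r c ((finSumFinEquiv.trans (finCongr (two_mul n).symm)).symm j)) =
      Nat.ofBits r + 2 ^ n * Nat.ofBits c := by
  set π : Fin n ⊕ Fin n ≃ Fin (2 * n) := finSumFinEquiv.trans (finCongr (two_mul n).symm) with hπ
  -- values of `π` on the two summands
  have hinl : ∀ x : Fin n, (π (Sum.inl x) : ℕ) = x := by
    intro x
    simp [hπ, Equiv.trans_apply, finSumFinEquiv_apply_left]
  have hinr : ∀ x : Fin n, (π (Sum.inr x) : ℕ) = n + x := by
    intro x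
    have : (π (Sum.inr x) : ℕ) = x + n := by simp [hπ, Equiv.trans_apply, finSumFinEquiv_apply_right]
    omega
  -- hence of `π.symm`
  have hlow : ∀ (i : ℕ) (hi : i < n) (h2 : i < 2 * n), π.symm ⟨i, h2⟩ = Sum.inl ⟨i, hi⟩ := by
    intro i hi h2
    rw [Equiv.symm_apply_eq]
    exact Fin.ext (by rw [hinl])
  have hhigh : ∀ (i : ℕ) (hi : n ≤ i) (h2 : i < 2 * n), π.symm ⟨i, h2⟩ = Sum.inr ⟨i - n, by omega⟩ := by
    intro i hi h2
    rw [Equiv.symm_apply_eq]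
    exact Fin.ext (by rw [hinr]; simp only; omega)
  apply Nat.eq_of_testBit_eq
  intro i
  rw [Nat.testBit_ofBits, add_comm, Nat.testBit_two_pow_mul_add _ (Nat.ofBits_lt_two_pow r)]
  by_cases h2 : i < 2 * n
  · rw [dif_pos h2]
    by_cases hi : i < n
    · rw [if_pos hi, hlow i hi h2, Sum.elim_inl, Nat.testBit_ofBits, dif_pos hi]
    · rw [if_neg hi, hhigh i (not_lt.mp hi) h2, Sum.elim_inr, Nat.testBit_ofBits, dif_pos (by omega)]
  · rw [dif_neg h2, if_neg (by omega), Nat.testBit_ofBits, dif_neg (by omega)]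

/-- `r ↦ ofBits r` is injective on bit vectors of length `n`. [folklore] -/
theorem ofBits_injective_boolVec (n : ℕ) : Function.Injective (fun r : Fin n → Bool => Nat.ofBits r) := by
  intro r r' h
  funext j
  have hj := congrArg (fun x : ℕ => x.testBit (j : ℕ)) h
  simpa [Nat.testBit_ofBits_lt _ _ j.isLt] using hj

/-- Re-indexing a sum over bit vectors by the integers `< 2^n` they encode. [folklore] -/
theorem sum_boolVec_eq_sum_fin {M : Type*} [AddCommMonoid M] (n : ℕ) (f : ℕ → M) :
    ∑ r : Fin n → Bool, f (Nat.ofBits r) = ∑ a : Fin (2 ^ n), f (a : ℕ) := by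
  refine Fintype.sum_bijective (fun r : Fin n → Bool => (⟨Nat.ofBits r, Nat.ofBits_lt_two_pow r⟩ : Fin (2 ^ n)))
    ?_ _ _ (fun _ => rfl)
  rw [Fintype.bijective_iff_injective_and_card]
  refine ⟨fun r r' h => ofBits_injective_boolVec n (congrArg Fin.val h), by simp⟩

/-! ## §2 `DigitalBilinearLiouville → AlignedTypeI` -/

/-- **`AlignedTypeI` is a rung of `DigitalBilinearLiouville`**: the bilinear bound on the aligned cut with `w ≡ 1` and
`u(r) = ±1` the sign of the row sum `Σ_b λ(a + 2^n b + 1)` (`a = ofBits r`) gives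
`(Σ_a |Σ_b λ(a + 2^n b + 1)|)² ≤ ε² 4^n · 2^n · 2^n`. [folklore] -/
theorem alignedTypeI_of_digitalBilinearLiouville
    (h : Summit.ValiantsHypothesis.ValiantsHypothesis.Theses.LiouvilleSarnak.DigitalBilinearLiouville) :
    Summit.ValiantsHypothesis.ValiantsHypothesis.Theses.LiouvilleSarnak.AlignedTypeI := by
  intro ε hε
  obtain ⟨n₀, hn₀⟩ := h (ε ^ 2) (by positivity)
  refine ⟨n₀, fun n hn => ?_⟩
  set π : Fin n ⊕ Fin n ≃ Fin (2 * n) := finSumFinEquiv.trans (finCongr (two_mul n).symm) with hπ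
  -- the aligned row sums, indexed by bit vectors and by integers
  set R : ℕ → ℝ := fun a => ∑ b : Fin (2 ^ n), ((liouville (a + 2 ^ n * (b : ℕ) + 1) : ℤ) : ℝ) with hR
  have hrow : ∀ r : Fin n → Bool,
      (∑ c : Fin n → Bool, ((liouville (Nat.ofBits (fun j : Fin (2 * n) => Sum.elim r c (π.symm j)) + 1) : ℤ) : ℂ))
        = ((R (Nat.ofBits r) : ℝ) : ℂ) := by
    intro r
    rw [hR]
    push_cast
    simp_rw [hπ, ofBits_alignedCut n r]
    exact sum_boolVec_eq_sum_fin n (fun b => ((liouville (Nat.ofBits r + 2 ^ n * b + 1) : ℤ) : ℂ))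
  -- the sign test vector
  set u : (Fin n → Bool) → ℂ := fun r => if 0 ≤ R (Nat.ofBits r) then 1 else -1 with hu
  have hu_norm : ∀ r, ‖u r‖ = 1 := by
    intro r
    simp only [hu]
    split_ifs <;> simp
  have hu_mul : ∀ r, u r * ((R (Nat.ofBits r) : ℝ) : ℂ) = ((|R (Nat.ofBits r)| : ℝ) : ℂ) := by
    intro r
    simp only [hu]
    split_ifs with h0
    · rw [one_mul, abs_of_nonneg h0]
    · rw [abs_of_neg (not_le.mp h0)]
      push_cast
      ring
  -- the bilinear bound on the aligned cut
  have hB := hn₀ n hn π u (fun _ => 1)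
  have hsum : (∑ r : Fin n → Bool, ∑ c : Fin n → Bool, u r * (1 : ℂ) *
      ((liouville (Nat.ofBits (fun j : Fin (2 * n) => Sum.elim r c (π.symm j)) + 1) : ℤ) : ℂ)) =
        ((∑ a : Fin (2 ^ n), |R a| : ℝ) : ℂ) := by
    have h1 : ∀ r : Fin n → Bool, (∑ c : Fin n → Bool, u r * (1 : ℂ) *
        ((liouville (Nat.ofBits (fun j : Fin (2 * n) => Sum.elim r c (π.symm j)) + 1) : ℤ) : ℂ)) =
          ((|R (Nat.ofBits r)| : ℝ) : ℂ) := by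
      intro r
      rw [← hu_mul r, ← hrow r, Finset.mul_sum]
      refine Finset.sum_congr rfl fun c _ => by ring
    simp_rw [h1]
    push_cast
    exact sum_boolVec_eq_sum_fin n (fun a => ((|R a| : ℝ) : ℂ))
  rw [hsum] at hB
  simp_rw [hu_norm, norm_one, one_pow, Finset.sum_const, Finset.card_univ, Fintype.card_fun, Fintype.card_bool,
    Fintype.card_fin, nsmul_eq_mul, mul_one] at hB
  -- `hB : ‖(S : ℂ)‖² ≤ ε² 4^n 2^n 2^n` with `S = Σ_a |R a|`
  have hS0 : (0 : ℝ) ≤ ∑ a : Fin (2 ^ n), |R a| := Finset.sum_nonneg fun _ _ => abs_nonneg _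
  rw [Complex.norm_real, Real.norm_eq_abs, abs_of_nonneg hS0] at hB
  have hB' : (∑ a : Fin (2 ^ n), |R a|) ^ 2 ≤ (ε * 4 ^ n) ^ 2 := by
    refine hB.trans (le_of_eq ?_)
    push_cast
    rw [show (4 : ℝ) ^ n = 2 ^ n * 2 ^ n by rw [← mul_pow]; norm_num]
    ring
  have hfin := (pow_le_pow_iff_left₀ hS0 (by positivity) two_ne_zero).mp hB'
  -- currency of `AlignedTypeI`
  have hgoal : (∑ a : Fin (2 ^ n), |∑ b : Fin (2 ^ n), ((liouville ((a : ℕ) + 2 ^ n * (b : ℕ) + 1) : ℤ) : ℝ)|)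
      = ∑ a : Fin (2 ^ n), |R a| := by
    rfl
  rw [hgoal]
  exact hfin

/-- The chain of the route's registered propositions at this leaf:
`DigitalBilinearLiouville → TwistedLiouvilleSmall` (through `AlignedTypeI ↔ KMTVariance`). [folklore] -/
theorem twistedLiouvilleSmall_of_digitalBilinearLiouville
    (h : Summit.ValiantsHypothesis.ValiantsHypothesis.Theses.LiouvilleSarnak.DigitalBilinearLiouville) :
    TwistedLiouvilleSmall :=
  twistedLiouvilleSmall_of_alignedTypeI (alignedTypeI_of_digitalBilinearLiouville h)

end Summit.ValiantsHypothesis.ValiantsHypothesis.Theorems.LiouvilleSarnak.AlignedTypeI.CharactersModTwoN
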